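import Literature.Analysis.Calculus.ExteriorSobolev
import Summits.FinalStateConjecture.FinalStateConjecture.Theorems.ClusterCompletenessAdiabaticMultiKerrILEDConstantAtInfinityAux
import Summits.FinalStateConjecture.FinalStateConjecture.Theorems.ClusterCompletenessAdiabaticMultiKerrILEDConstantAtInfinityBalls

/-!
# Route ClusterCompleteness — crux `AdiabaticMultiKerrILED`, line `Sketch`: constant at infinity

Helper file for the crux `stmt-FinalStateConjecture-14310`
(`Summit.FinalStateConjecture.FinalStateConjecture.Theses.ClusterCompleteness.AdiabaticMultiKerrILED`):
the stub `stub_constantAtInfinity` of line `Sketch`. A function `φ`, `C¹` on `{R₀ < ‖y‖} ⊆ ℝ³` with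
`∫_{R₀ < ‖y‖} ‖Dφ‖² < ∞`, has a constant `c` at infinity in the Hardy sense:
`∫_{ρ < ‖y‖} (φ − c)²/‖y‖² < ∞` for `ρ = 20 R₀` (Deny–Lions lemma / Sobolev at infinity, `n = 3`;
only finiteness is asserted).

Proof (dyadic, no spherical means): truncate `φ` near the inner sphere to `f ∈ C¹(ℝ³)`, `f = φ` on
`{2R₀ ≤ ‖y‖}` (`Literature.Analysis.Calculus.contDiff_cutoff_mul`); at scale `uₖ = 2R₀ 2^k` cover
`{10uₖ ≤ ‖y‖ ≤ 20uₖ}` by the six balls `B(40uₖ(±eᵢ), 39uₖ)` of the companion file `…Balls`; on each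
ball Poincaré bounds `f` minus its mean by `uₖ²` times the energy `Eₖ` of the thick shell
`{uₖ < ‖y‖ ≤ 2^7 uₖ}`, and `∑ Eₖ ≤ 7 ∫ ‖Dφ‖²` (`…Aux`, bounded overlap); means of overlapping balls
satisfy `uₖ (a − a')² ≲ Eₖ + Eₖ₊₁`, so the means `aₖ` along `+e₀` obey the discrete Hardy inequality
`∑ 2^k (aₖ − c)² < ∞` (`…Aux.discrete_hardy`), every other mean at scale `k` is within the same
error of `aₖ`, and summing `∫_B (φ − c)²/‖y‖² ≤ uₖ⁻² (2 ∫_B (f − a_B)² + 2 |B| (a_B − c)²)` over the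
cover gives a finite total. [folklore]
-/

noncomputable section

-- the doubled `FinalStateConjecture.FinalStateConjecture` path component trips dupNamespace
set_option linter.dupNamespace false

open scoped ENNReal NNReal Topology InnerProductSpace
open MeasureTheory Set Metric Filter Literature.Geometry.Lorentzian

namespace Summit.FinalStateConjecture.FinalStateConjecture.Cruxes.AdiabaticMultiKerrILED.Sketch

open ConstantAtInfinity

/-- **Constant at infinity.** A function `C¹` outside a ball of `ℝ³` with finite Dirichlet energy there
differs from some constant `c` by a function in the Hardy class far out:
`∫_{ρ < |y|} (φ − c)²/|y|² < ∞` for some `ρ ≥ R₀` (Deny–Lions / Sobolev at infinity, `n = 3`).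
Proof: truncate `φ` to `f ∈ C¹(ℝ³)` equal to `φ` on `{2R₀ ≤ ‖y‖}`; cover `{20R₀ < ‖y‖}` by the balls
`B(40uₖ(±eᵢ), 39uₖ)`, `uₖ = 2R₀2^k`; on each ball Poincaré controls `f` minus its mean by the
energy of the thick shell `{uₖ < ‖y‖ ≤ 2^7 uₖ}` (bounded overlap); means of overlapping balls differ
by `O((energy/uₖ)^{1/2})`, so the means along `e₀` converge to `c` with the discrete Hardy bound
`∑ 2^k (aₖ − c)² < ∞`, and every other mean at scale `k` is within the same error of `aₖ`. [folklore] -/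
theorem stub_constantAtInfinity :
    ∀ (φ : E3 → ℝ) (R₀ : ℝ), 0 < R₀ → (∀ y : E3, R₀ < ‖y‖ → ContDiffAt ℝ 1 φ y) →
      (∫⁻ y in {y : E3 | R₀ < ‖y‖}, ENNReal.ofReal (‖fderiv ℝ φ y‖ ^ 2)) ≠ ⊤ →
      ∃ c ρ : ℝ, R₀ ≤ ρ ∧
        ∫⁻ y in {y : E3 | ρ < ‖y‖}, ENNReal.ofReal ((φ y - c) ^ 2 / ‖y‖ ^ 2) < ⊤ := by
  intro φ R hR hφ hD
  -- Step 0: a `C¹` function `f` on all of `ℝ³`, equal to `φ` on `{2R ≤ ‖y‖}`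
  obtain ⟨ψ₀, hψ₀s, hψ₀0, hψ₀1, -⟩ :=
    Literature.Analysis.Calculus.exists_smooth_radial_cutoff_between (E := E3)
      (a := 3 * R / 2) (b := 2 * R) (by positivity) (by linarith)
  set f : E3 → ℝ := fun y => ψ₀ y * φ y with hfdef
  have hφon : ContDiffOn ℝ 1 φ {y : E3 | R < ‖y‖} := fun y hy => (hφ y hy).contDiffWithinAt
  have hf1 : ContDiff ℝ 1 f :=
    Literature.Analysis.Calculus.contDiff_cutoff_mul (hψ₀s.of_le (by exact_mod_cast le_top))
      (show R < 3 * R / 2 by linarith) (fun y hy => hψ₀0 y hy.le) hφon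
  have hfφ : ∀ y : E3, 2 * R ≤ ‖y‖ → f y = φ y := fun y hy => by
    simp only [hfdef, hψ₀1 y hy, one_mul]
  have hDf : ∀ y : E3, 2 * R < ‖y‖ → fderiv ℝ f y = fderiv ℝ φ y := by
    intro y hy
    have hev : f =ᶠ[𝓝 y] φ := by
      filter_upwards [(isOpen_lt continuous_const continuous_norm).mem_nhds hy] with z hz
      exact hfφ z (le_of_lt hz)
    exact hev.fderiv_eq
  -- Step 1: dyadic scales `u k = 2R 2^k`, thick shells and their energies
  set G : E3 → ℝ≥0∞ := fun y => ENNReal.ofReal (‖fderiv ℝ φ y‖ ^ 2) with hGdef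
  set u : ℕ → ℝ := fun k => 2 * R * 2 ^ k with hudef
  have hu0 : ∀ k, 0 < u k := fun k => by positivity
  have huR : ∀ k, 2 * R ≤ u k := fun k =>
    le_mul_of_one_le_right (by positivity) (one_le_pow₀ one_le_two)
  have hu1 : ∀ k, u (k + 1) = 2 * u k := fun k => by simp only [hudef, pow_succ]; ring
  set Tk : ℕ → Set E3 := fun k => {y | u k < ‖y‖ ∧ ‖y‖ ≤ u k * 2 ^ 7} with hTdef
  set En : ℕ → ℝ≥0∞ := fun k => ∫⁻ y in Tk k, G y with hEdef
  have hEsum : ∑' k, En k ≠ ⊤ := by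
    have h1 := tsum_setLIntegral_dyadic_le G (R := 2 * R) (by positivity)
    have h2 : ∫⁻ y in {y : E3 | 2 * R < ‖y‖}, G y ≤ ∫⁻ y in {y : E3 | R < ‖y‖}, G y :=
      lintegral_mono_set fun y (hy : 2 * R < ‖y‖) => show R < ‖y‖ by linarith
    have h3 : ∀ k, Tk k = {y : E3 | 2 * R * 2 ^ k < ‖y‖ ∧ ‖y‖ ≤ 2 * R * 2 ^ (k + 7)} := by
      intro k
      ext y
      simp only [hTdef, hudef, mem_setOf_eq, pow_add, mul_assoc]
    have h4 : 7 * ∫⁻ y in {y : E3 | 2 * R < ‖y‖}, G y ≠ ⊤ :=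
      ENNReal.mul_ne_top (by norm_num) (ne_top_of_le_ne_top hD h2)
    refine ne_top_of_le_ne_top h4 ?_
    calc ∑' k, En k
        = ∑' k, ∫⁻ y in {y : E3 | 2 * R * 2 ^ k < ‖y‖ ∧ ‖y‖ ≤ 2 * R * 2 ^ (k + 7)}, G y := by
          simp only [hEdef, h3]
      _ ≤ 7 * ∫⁻ y in {y : E3 | 2 * R < ‖y‖}, G y := h1
  -- Step 2: the balls `P k i b = B(40 u_k σ_b e_i, 39 u_k)` and their means
  set σ : Bool → ℝ := fun b => if b then 1 else -1 with hσdef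
  set dir : Fin 3 → Bool → E3 := fun i b => EuclideanSpace.single i (σ b) with hdirdef
  have hdir1 : ∀ i b, ‖dir i b‖ = 1 := fun i b => by
    cases b <;> simp [hdirdef, hσdef, PiLp.norm_single]
  have hdir0 : ∀ i j b b', i ≠ j → ⟪dir i b, dir j b'⟫_ℝ = 0 := fun i j b b' hij => by
    simp [hdirdef, EuclideanSpace.inner_single_left, hij]
  set P : ℕ → Fin 3 → Bool → Set E3 :=
    fun k i b => ball ((40 * u k) • dir i b) (39 * u k) with hPdef
  set a : ℕ → Fin 3 → Bool → ℝ := fun k i b => ⨍ y in P k i b, f y with hadef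
  have hPT : ∀ k i b, P k i b ⊆ Tk k := fun k i b => ball_subset_shell (hu0 k) (hdir1 i b)
  have hPu : ∀ k i b, P k i b ⊆ {y : E3 | u k < ‖y‖} := fun k i b y hy => (hPT k i b hy).1
  set β : ℝ≥0∞ := volume (ball (0 : E3) 1) with hβ
  have hβ0 : β ≠ 0 := (measure_ball_pos volume (0 : E3) one_pos).ne'
  have hβtop : β ≠ ⊤ := measure_ball_lt_top.ne
  set Kov : ℝ≥0∞ := 16 * ENNReal.ofReal (4 * 78 ^ 2 / 10 ^ 3) * β⁻¹ with hKov
  have hKovtop : Kov ≠ ⊤ :=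
    ENNReal.mul_ne_top (ENNReal.mul_ne_top (by norm_num) ENNReal.ofReal_ne_top)
      (ENNReal.inv_ne_top.2 hβ0)
  -- (i) consecutive scales along one direction
  have hscale : ∀ k i b,
      ENNReal.ofReal (u k) * ‖a k i b - a (k + 1) i b‖ₑ ^ 2 ≤ Kov * (En k + En (k + 1)) := by
    intro k i b
    refine mean_sub_mean_le hf1 hDf (hu0 k) (huR k) (huR (k + 1)) (m := (40 * u k) • dir i b)
      (by positivity) (by positivity) (by linarith [hu0 k]) (by rw [hu1]; linarith [hu0 k])
      (hPT k i b) (hPT (k + 1) i b) (ball_subset_ball (by linarith [hu0 k])) ?_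
    rw [hu1]
    exact ball_subset_ball_double (hu0 k) (hdir1 i b)
  -- (ii) two directions at one scale
  have horth : ∀ k i j b b', i ≠ j →
      ENNReal.ofReal (u k) * ‖a k i b - a k j b'‖ₑ ^ 2 ≤ Kov * (En k + En k) := by
    intro k i j b b' hij
    refine mean_sub_mean_le hf1 hDf (hu0 k) (huR k) (huR k)
      (m := (20 * u k) • (dir i b + dir j b')) (by positivity) (by positivity)
      (by linarith [hu0 k]) (by linarith [hu0 k]) (hPT k i b) (hPT k j b')
      (ball_subset_ball_orth (hu0 k) (hdir1 i b) (hdir1 j b') (hdir0 i j b b' hij)) ?_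
    rw [add_comm (dir i b)]
    exact ball_subset_ball_orth (hu0 k) (hdir1 j b') (hdir1 i b) (hdir0 j i b' b hij.symm)
  -- (iii) every direction against the reference direction `(0, true)`
  have htri : ∀ x y z : ℝ, ‖x - z‖ₑ ^ 2 ≤ 2 * ‖x - y‖ₑ ^ 2 + 2 * ‖y - z‖ₑ ^ 2 := by
    intro x y z
    calc ‖x - z‖ₑ ^ 2 = ‖(x - y) + (y - z)‖ₑ ^ 2 := by rw [sub_add_sub_cancel]
      _ ≤ (‖x - y‖ₑ + ‖y - z‖ₑ) ^ 2 := pow_le_pow_left' (enorm_add_le _ _) 2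
      _ ≤ _ := Literature.Analysis.FluidPDE.PoincareBall.add_sq_le_two_mul_sq_add _ _
  have href : ∀ k i b, ENNReal.ofReal (u k) * ‖a k i b - a k 0 true‖ₑ ^ 2 ≤ 8 * Kov * En k := by
    intro k i b
    by_cases hi : i = 0
    · subst hi
      cases b
      · calc ENNReal.ofReal (u k) * ‖a k 0 false - a k 0 true‖ₑ ^ 2
            ≤ ENNReal.ofReal (u k) * (2 * ‖a k 0 false - a k 1 true‖ₑ ^ 2 +
                2 * ‖a k 1 true - a k 0 true‖ₑ ^ 2) := mul_le_mul_right (htri _ _ _) _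
          _ = 2 * (ENNReal.ofReal (u k) * ‖a k 0 false - a k 1 true‖ₑ ^ 2) +
                2 * (ENNReal.ofReal (u k) * ‖a k 1 true - a k 0 true‖ₑ ^ 2) := by ring
          _ ≤ 2 * (Kov * (En k + En k)) + 2 * (Kov * (En k + En k)) :=
              add_le_add (mul_le_mul_right (horth k 0 1 false true (by decide)) _)
                (mul_le_mul_right (horth k 1 0 true true (by decide)) _)
          _ = 8 * Kov * En k := by ring
      · simp
    · calc ENNReal.ofReal (u k) * ‖a k i b - a k 0 true‖ₑ ^ 2 ≤ Kov * (En k + En k) :=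
            horth k i 0 b true hi
        _ = 2 * Kov * En k := by ring
        _ ≤ 8 * Kov * En k := by gcongr; norm_num
  -- Step 3: the discrete Hardy inequality for the reference means
  have h2R0 : ENNReal.ofReal (2 * R) ≠ 0 := by
    rw [ne_eq, ENNReal.ofReal_eq_zero, not_le]; positivity
  have hsplit : ∀ k, ENNReal.ofReal (u k) = ENNReal.ofReal (2 * R) * 2 ^ k := fun k => by
    simp only [hudef]
    rw [ENNReal.ofReal_mul (by positivity), ENNReal.ofReal_pow zero_le_two, ENNReal.ofReal_ofNat]
  have hincr : ∀ k, 2 ^ k * ‖a (k + 1) 0 true - a k 0 true‖ₑ ^ 2 ≤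
      (ENNReal.ofReal (2 * R))⁻¹ * Kov * (En k + En (k + 1)) := by
    intro k
    calc 2 ^ k * ‖a (k + 1) 0 true - a k 0 true‖ₑ ^ 2
        = (ENNReal.ofReal (2 * R))⁻¹ *
            (ENNReal.ofReal (u k) * ‖a k 0 true - a (k + 1) 0 true‖ₑ ^ 2) := by
          rw [hsplit, ← enorm_neg, neg_sub, ← mul_assoc, ← mul_assoc,
            ENNReal.inv_mul_cancel h2R0 ENNReal.ofReal_ne_top, one_mul]
      _ ≤ (ENNReal.ofReal (2 * R))⁻¹ * (Kov * (En k + En (k + 1))) :=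
          mul_le_mul_right (hscale k 0 true) _
      _ = _ := by ring
  obtain ⟨c, hc⟩ := discrete_hardy (fun k => a k 0 true) (fun k => En k + En (k + 1))
    ((ENNReal.ofReal (2 * R))⁻¹ * Kov) hincr
  have hHardy : ∑' k, 2 ^ k * ‖a k 0 true - c‖ₑ ^ 2 ≠ ⊤ := by
    refine ne_top_of_le_ne_top ?_ hc
    have h1 : ∑' k, (En k + En (k + 1)) ≠ ⊤ := by
      rw [ENNReal.tsum_add]
      exact ENNReal.add_ne_top.2 ⟨hEsum, ne_top_of_le_ne_top hEsum
        (ENNReal.tsum_comp_le_tsum_of_injective (add_left_injective 1) En)⟩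
    exact ENNReal.mul_ne_top (ENNReal.mul_ne_top (by norm_num)
      (ENNReal.mul_ne_top (ENNReal.inv_ne_top.2 h2R0) hKovtop)) h1
  -- Step 4: the estimate on one ball of the cover
  set C₁ : ℝ≥0∞ := 16 * ENNReal.ofReal (4 * 39 ^ 2) with hC₁
  set C₂ : ℝ≥0∞ := 2 * ENNReal.ofReal (39 ^ 3) * β with hC₂
  set D₁ : ℝ≥0∞ := C₁ + C₂ * (2 * (8 * Kov)) with hD₁
  set D₂ : ℝ≥0∞ := C₂ * 2 * ENNReal.ofReal (2 * R) with hD₂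
  set X : ℕ → ℝ≥0∞ := fun k => D₁ * En k + D₂ * (2 ^ k * ‖a k 0 true - c‖ₑ ^ 2) with hX
  have hball : ∀ k i b, ∫⁻ y in P k i b, ENNReal.ofReal ((φ y - c) ^ 2 / ‖y‖ ^ 2) ≤ X k := by
    intro k i b
    have h1 := setLIntegral_sq_div_le (φ := φ) hf1.continuous (hu0 k) measurableSet_ball
      (hPu k i b) (fun y hy => hfφ y ((huR k).trans (le_of_lt ((hPu k i b) hy)))) c
    have hdev := dev_ball_le hf1 hDf (huR k) (c := (40 * u k) • dir i b) (r := 39 * u k)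
      (by positivity) (hPT k i b)
    have hvol : volume (P k i b) = ENNReal.ofReal ((39 * u k) ^ 3) * β := by
      simp only [hPdef]
      rw [Measure.addHaar_ball_of_pos volume _ (by positivity : 0 < 39 * u k),
        finrank_euclideanSpace_fin]
    have hac : ENNReal.ofReal (u k) * ‖a k i b - c‖ₑ ^ 2 ≤
        2 * (8 * Kov * En k) + 2 * (ENNReal.ofReal (2 * R) * (2 ^ k * ‖a k 0 true - c‖ₑ ^ 2)) := by
      calc ENNReal.ofReal (u k) * ‖a k i b - c‖ₑ ^ 2
          ≤ ENNReal.ofReal (u k) * (2 * ‖a k i b - a k 0 true‖ₑ ^ 2 +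
              2 * ‖a k 0 true - c‖ₑ ^ 2) := mul_le_mul_right (htri _ _ _) _
        _ = 2 * (ENNReal.ofReal (u k) * ‖a k i b - a k 0 true‖ₑ ^ 2) +
              2 * (ENNReal.ofReal (2 * R) * (2 ^ k * ‖a k 0 true - c‖ₑ ^ 2)) := by
            rw [hsplit]; ring
        _ ≤ _ := add_le_add (mul_le_mul_right (href k i b) _) le_rfl
    have hs1 : ENNReal.ofReal (u k ^ 2)⁻¹ * (2 * (8 * ENNReal.ofReal (4 * (39 * u k) ^ 2))) =
        C₁ := by
      have hk := hu0 k
      calc ENNReal.ofReal (u k ^ 2)⁻¹ * (2 * (8 * ENNReal.ofReal (4 * (39 * u k) ^ 2)))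
          = 16 * (ENNReal.ofReal (u k ^ 2)⁻¹ * ENNReal.ofReal (4 * (39 * u k) ^ 2)) := by ring
        _ = 16 * ENNReal.ofReal (4 * 39 ^ 2) := by
            rw [← ENNReal.ofReal_mul (by positivity)]
            congr 2
            field_simp
    have hs2 : ENNReal.ofReal (u k ^ 2)⁻¹ * (2 * (ENNReal.ofReal ((39 * u k) ^ 3) * β)) =
        C₂ * ENNReal.ofReal (u k) := by
      have hk := hu0 k
      calc ENNReal.ofReal (u k ^ 2)⁻¹ * (2 * (ENNReal.ofReal ((39 * u k) ^ 3) * β))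
          = 2 * (ENNReal.ofReal (u k ^ 2)⁻¹ * ENNReal.ofReal ((39 * u k) ^ 3)) * β := by ring
        _ = 2 * (ENNReal.ofReal (39 ^ 3) * ENNReal.ofReal (u k)) * β := by
            rw [← ENNReal.ofReal_mul (by positivity), ← ENNReal.ofReal_mul (by positivity)]
            congr 3
            field_simp
        _ = C₂ * ENNReal.ofReal (u k) := by ring
    calc ∫⁻ y in P k i b, ENNReal.ofReal ((φ y - c) ^ 2 / ‖y‖ ^ 2)
        ≤ ENNReal.ofReal (u k ^ 2)⁻¹ *
            (2 * (∫⁻ y in P k i b, ‖f y - ⨍ z in P k i b, f z‖ₑ ^ 2) +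
              2 * volume (P k i b) * ‖(⨍ z in P k i b, f z) - c‖ₑ ^ 2) := h1
      _ ≤ ENNReal.ofReal (u k ^ 2)⁻¹ * (2 * (8 * ENNReal.ofReal (4 * (39 * u k) ^ 2) * En k) +
            2 * volume (P k i b) * ‖a k i b - c‖ₑ ^ 2) := by
          gcongr
      _ = C₁ * En k + (C₂ * ENNReal.ofReal (u k)) * ‖a k i b - c‖ₑ ^ 2 := by
          rw [hvol, ← hs1, ← hs2]; ring
      _ = C₁ * En k + C₂ * (ENNReal.ofReal (u k) * ‖a k i b - c‖ₑ ^ 2) := by ring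
      _ ≤ C₁ * En k + C₂ * (2 * (8 * Kov * En k) +
            2 * (ENNReal.ofReal (2 * R) * (2 ^ k * ‖a k 0 true - c‖ₑ ^ 2))) :=
          add_le_add le_rfl (mul_le_mul_right hac _)
      _ = X k := by simp only [hX, hD₁, hD₂]; ring
  -- Step 5: the cover of `{20 R < ‖y‖}` and the sum
  refine ⟨c, 20 * R, by linarith, ?_⟩
  have hcover : {y : E3 | 20 * R < ‖y‖} ⊆ ⋃ p : ℕ × Fin 3 × Bool, P p.1 p.2.1 p.2.2 := by
    intro y hy
    have hy' : 20 * R < ‖y‖ := hy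
    obtain ⟨k, hk1, hk2⟩ := exists_nat_pow_near (x := ‖y‖ / (20 * R)) (y := 2)
      ((one_le_div (by positivity)).2 hy'.le) one_lt_two
    have h10 : 10 * u k ≤ ‖y‖ := by
      have := (le_div_iff₀ (by positivity : (0 : ℝ) < 20 * R)).1 hk1
      simp only [hudef]; linarith
    have h20 : ‖y‖ ≤ 20 * u k := by
      have := (div_lt_iff₀ (by positivity : (0 : ℝ) < 20 * R)).1 hk2
      simp only [hudef]; rw [pow_succ] at this; linarith
    obtain ⟨i, b, hib⟩ := exists_mem_ball_of_mem_shell (hu0 k) h10 h20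
    exact mem_iUnion.2 ⟨(k, i, b), hib⟩
  have hD₁ : D₁ ≠ ⊤ := by
    refine ENNReal.add_ne_top.2 ⟨ENNReal.mul_ne_top (by norm_num) ENNReal.ofReal_ne_top, ?_⟩
    refine ENNReal.mul_ne_top (ENNReal.mul_ne_top (ENNReal.mul_ne_top (by norm_num)
      ENNReal.ofReal_ne_top) hβtop) ?_
    exact ENNReal.mul_ne_top (by norm_num) (ENNReal.mul_ne_top (by norm_num) hKovtop)
  have hD₂ : D₂ ≠ ⊤ :=
    ENNReal.mul_ne_top (ENNReal.mul_ne_top (ENNReal.mul_ne_top (ENNReal.mul_ne_top (by norm_num)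
      ENNReal.ofReal_ne_top) hβtop) (by norm_num)) ENNReal.ofReal_ne_top
  have hXsum : ∑' k, X k ≠ ⊤ := by
    simp only [hX]
    rw [ENNReal.tsum_add, ENNReal.tsum_mul_left, ENNReal.tsum_mul_left]
    exact ENNReal.add_ne_top.2 ⟨ENNReal.mul_ne_top hD₁ hEsum, ENNReal.mul_ne_top hD₂ hHardy⟩
  have h6 : ∀ k, ∑' q : Fin 3 × Bool, X k = 6 * X k := fun k => by
    rw [tsum_fintype, Finset.sum_const, Finset.card_univ, nsmul_eq_mul]
    norm_num
  calc ∫⁻ y in {y : E3 | 20 * R < ‖y‖}, ENNReal.ofReal ((φ y - c) ^ 2 / ‖y‖ ^ 2)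
      ≤ ∫⁻ y in ⋃ p : ℕ × Fin 3 × Bool, P p.1 p.2.1 p.2.2,
          ENNReal.ofReal ((φ y - c) ^ 2 / ‖y‖ ^ 2) := lintegral_mono_set hcover
    _ ≤ ∑' p : ℕ × Fin 3 × Bool, ∫⁻ y in P p.1 p.2.1 p.2.2,
          ENNReal.ofReal ((φ y - c) ^ 2 / ‖y‖ ^ 2) := lintegral_iUnion_le _ _
    _ ≤ ∑' p : ℕ × Fin 3 × Bool, X p.1 := ENNReal.tsum_le_tsum fun p => hball p.1 p.2.1 p.2.2
    _ = ∑' k, ∑' q : Fin 3 × Bool, X k :=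
        ENNReal.tsum_prod' (f := fun p : ℕ × (Fin 3 × Bool) => X p.1)
    _ = ∑' k, 6 * X k := by simp only [h6]
    _ = 6 * ∑' k, X k := ENNReal.tsum_mul_left
    _ < ⊤ := (ENNReal.mul_ne_top (by norm_num) hXsum).lt_top

end Summit.FinalStateConjecture.FinalStateConjecture.Cruxes.AdiabaticMultiKerrILED.Sketch

end
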